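import Literature.NumberTheory.ConnesConsani2021.ArchKernelModesMISound
import Literature.NumberTheory.ConnesConsani2021.ArchKernelTier2Panels
import HarnessLib

/-!
# Connes–Consani 2021 §5–§6, the (E-a) kernel certificate — TRUNCATION BOUNDS of the Frobenius derivative
# series feeding the S₈ panel models (piece (F) of the (T2b-sound) assembly)

RH-FREE (label, line 1).  bears_on (cell rh-crit, corpus C1): route «ConnesConsaniSemilocal» item K3
`WindowSpectralBound` (stmt 19306) — the (E-a) conjunct of `CC2021_section6_enclosures`; (T2b-sound) of the Tier-2
SPEC (assembler t4 g4 `ArchKernelTier2S8Sound`, cc-lead R126/R131), over the LANDED data modules K1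
`ArchKernelModesMI` (eng-1 g2) and T2d `ArchKernelTier2Panels` (cc-iso g4) and the soundness layer
`ArchKernelModesMISound` (gm-t16 g2).

WHAT THIS FILE PROVES.  For a mode `d` and every real `χ` in its bracket, write `f_k(χ) := (k+1)·a_{k+1}(χ)` (so
`u′(y) = frobSol₁ 1 χ y = −Σ_k f_k (1−y)^k`) and `g_i := f_i − 2f_{i−1} + f_{i−2}` (the `combine` shift rule of
`ArchKernelTier2Panels`).  The per-mode integers of cc-iso's `readMode` are re-defined here as clean computable
mirrors — `fAbs d k = absHi((A_{k+1}·(k+1)))`, `FpB` (= `wAbs`), `toutB`, `tinB`, `GsB`, `tHiB` — and shown to be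
SOUND real bounds:
* `abs_frobSol₁_add_sum_le_partial` — the split truncation on the window `y ∈ [0,2]`:
  `|u′(y) + Σ_{k<Kt} f_k w^k| ≤ Σ_{Kt ≤ k < K} |f_k|·|w|^k + DT/S` (`w = 1 − y`, any `Kt ≤ K`);
* (iv) `abs_frobSol₁_add_sum_le_toutB` (outer truncation, `y ∈ [1,2]`), (v) `abs_frobSol₁_le_FpB` (`sup |u′|`),
  (ii) `abs_frobSol₁_add_sum_le_tinB`, (iii) `abs_gsum_le_GsB`, (i) `abs_sq_mul_frobSol₁_add_gsum_le_tinB`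
  (inner truncations on `x ∈ [½,1]`, via the identity `Σ_{i<m+2} g_i wⁱ = F_{m+2} − 2w·F_{m+1} + w²·F_m`);
* (vi) `wBound` — the ONE inequality tying the per-mode bounds to the allowance `combinedLit.W` of the landed panel
  data: `Σ_{n<8} t(n)·(√2(δG·A + B·δo) + δi + 2√2·δo) ≤ W/S`, from a single `decide +kernel` integer check
  `wCheck_eq_true` (`√2 ≤ 283/200`; the integers are `readMode`'s own, so `combine`'s roundings are in our favour).
Source of the numbers: A. Connes, C. Consani, Selecta Math. 27 (2021), Prop. 5.3 / Lemma 5.4 §5 pp. 32–33 and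
§6.3–6.4 p. 24 [cite: ConnesConsani2021, Prop. 5.3 / Lemma 5.4 §5 pp. 32–33 and §6.3–6.4 p. 24]; Frobenius method
[cite: CoddingtonLevinson1955, Ch. 4 §8].  Nothing here mentions ζ or RH; nothing here bears on the truth of RH.
-/

noncomputable section

namespace Literature.NumberTheory.ConnesConsani2021.ArchCert

open Literature.Analysis.ValidatedNumerics.NumericsMP Literature.NumberTheory.LFunctions Finset Real Set

/-! ## The computable per-mode integers (mirrors of `ArchCertT2.readMode`) and the ONE kernel check -/

section computable

/-- `fAbs d k = absHi(A_{k+1}·(k+1)) ≥ S·|f_k(χ)|` (`readMode`'s `absf[k]`). [cite: ConnesConsani2021, Prop. 5.3 / Lemma 5.4 §5 pp. 32–33 and §6.3–6.4 p. 24 (in-kernel certificate for the §6 kernel enclosure)] -/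
def fAbs (d : ModeData) (k : ℕ) : ℤ := ((frobCoeffMI d.chi (k + 1)).mulInt ((k : ℤ) + 1)).absHi

/-- `FpB d = Σ_{k<K} fAbs d k + DT ≥ S·sup_{|w|≤1}|u′|` (`readMode`'s `wAbs`). [cite: ConnesConsani2021, Prop. 5.3 / Lemma 5.4 §5 pp. 32–33 and §6.3–6.4 p. 24 (in-kernel certificate for the §6 kernel enclosure)] -/
def FpB (d : ModeData) : ℤ := (∑ k ∈ Finset.range d.K, fAbs d k) + d.tail.DT

/-- `toutB d Kout = Σ_{Kout≤k<K} fAbs d k + DT ≥ S·sup_{|w|≤1}|u′ + F_{Kout}|` (`readMode`'s `tout`). [cite: ConnesConsani2021, Prop. 5.3 / Lemma 5.4 §5 pp. 32–33 and §6.3–6.4 p. 24 (in-kernel certificate for the §6 kernel enclosure)] -/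
def toutB (d : ModeData) (Kout : ℕ) : ℤ := (∑ k ∈ Finset.Ico Kout d.K, fAbs d k) + d.tail.DT

/-- `tinB d Kin = 4·(Σ_{Kin−2≤k<K} (fAbs d k / 2ᵏ + 1) + DT)` (`readMode`'s `tin`). [cite: ConnesConsani2021, Prop. 5.3 / Lemma 5.4 §5 pp. 32–33 and §6.3–6.4 p. 24 (in-kernel certificate for the §6 kernel enclosure)] -/
def tinB (d : ModeData) (Kin : ℕ) : ℤ := 4 * ((∑ k ∈ Finset.Ico (Kin - 2) d.K, (fAbs d k / 2 ^ k + 1)) + d.tail.DT)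

/-- `GsB d Kin = 4·Σ_{k<Kin} (fAbs d k / 2ᵏ + 1)` (`readMode`'s `Gs`). [cite: ConnesConsani2021, Prop. 5.3 / Lemma 5.4 §5 pp. 32–33 and §6.3–6.4 p. 24 (in-kernel certificate for the §6 kernel enclosure)] -/
def GsB (d : ModeData) (Kin : ℕ) : ℤ := 4 * ∑ k ∈ Finset.range Kin, (fAbs d k / 2 ^ k + 1)

/-- `tHiB d = max (t-interval).hi 0` (`combine`'s `max m.t.hi 0`). [cite: ConnesConsani2021, Prop. 5.3 / Lemma 5.4 §5 pp. 32–33 and §6.3–6.4 p. 24 (in-kernel certificate for the §6 kernel enclosure)] -/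
def tHiB (d : ModeData) : ℤ :=
  match modeQuantities d with
  | some q => max q.2.2.2.hi 0
  | none => 0

/-- The outer truncation order of mode `n` (`(truncOrders[n]).2`: 34 for `n ≤ 4`, 30 for `n = 5,6,7`). [cite: ConnesConsani2021, Prop. 5.3 / Lemma 5.4 §5 pp. 32–33 and §6.3–6.4 p. 24 (in-kernel certificate for the §6 kernel enclosure)] -/
def koutAt (n : ℕ) : ℕ := (ArchCertT2.truncOrders.getD n (24, 34)).2

/-- The default mode (as in `chainOK`). [cite: ConnesConsani2021, Prop. 5.3 / Lemma 5.4 §5 pp. 32–33 and §6.3–6.4 p. 24 (in-kernel certificate for the §6 kernel enclosure)] -/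
def dflt0 : ModeData := ⟨0, 0, 0, false, ⟨0, 0, 0, 0⟩⟩

/-- Mode `n` of record. [cite: ConnesConsani2021, Prop. 5.3 / Lemma 5.4 §5 pp. 32–33 and §6.3–6.4 p. 24 (in-kernel certificate for the §6 kernel enclosure)] -/
def modeAt (n : ℕ) : ModeData := modes.getD n dflt0

/-- The scaled integer form of the per-mode residual `√2(δG·A + B·δo) + δi + 2√2·δo` with `√2 ↦ 283/200`,
times `200·S²`. [cite: ConnesConsani2021, Prop. 5.3 / Lemma 5.4 §5 pp. 32–33 and §6.3–6.4 p. 24 (in-kernel certificate for the §6 kernel enclosure)] -/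
def residInt (n : ℕ) : ℤ :=
  283 * (tinB (modeAt n) 24 * FpB (modeAt n) + GsB (modeAt n) 24 * toutB (modeAt n) (koutAt n)) +
    200 * (S : ℤ) * tinB (modeAt n) 24 + 566 * (S : ℤ) * toutB (modeAt n) (koutAt n)

/-- THE CHECK: `Σ_{n<8} tHiB·residInt ≤ 200·S²·W`. [cite: ConnesConsani2021, Prop. 5.3 / Lemma 5.4 §5 pp. 32–33 and §6.3–6.4 p. 24 (in-kernel certificate for the §6 kernel enclosure)] -/
def wCheck : Bool :=
  decide (((List.range 8).map fun n ↦ tHiB (modeAt n) * residInt n).sum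
    ≤ 200 * (S : ℤ) * (S : ℤ) * ArchCertT2.combinedLit.W)

/-- **Kernel evaluation of the check.** [cite: ConnesConsani2021, Prop. 5.3 / Lemma 5.4 §5 pp. 32–33 and §6.3–6.4 p. 24 (in-kernel certificate for the §6 kernel enclosure)] -/
theorem wCheck_eq_true : wCheck = true := by
  decide +kernel

end computable

/-! ## Small arithmetic helpers -/

/-- Integer floor division against reals: `n/m ≤ ⌊n/m⌋ + 1` (`m > 0`). [folklore] -/
private theorem int_div_real_le_ediv_add_one (n : ℤ) {m : ℤ} (hm : 0 < m) :
    (n : ℝ) / m ≤ ((n / m : ℤ) : ℝ) + 1 := by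
  have h1 : n % m < m := Int.emod_lt_of_pos n hm
  have h3 : n % m + m * (n / m) = n := Int.emod_add_mul_ediv n m
  have hmr : (0 : ℝ) < m := by exact_mod_cast hm
  rw [div_le_iff₀ hmr]
  have h3r : ((n % m : ℤ) : ℝ) + (m : ℝ) * ((n / m : ℤ) : ℝ) = n := by exact_mod_cast h3
  have h1r : ((n % m : ℤ) : ℝ) < m := by exact_mod_cast h1
  have h0 : (0 : ℝ) ≤ ((n % m : ℤ) : ℝ) := by exact_mod_cast Int.emod_nonneg n hm.ne'
  nlinarith

/-- `((List.range n).map g).sum = Σ_{i<n} g i`. [folklore] -/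
private theorem list_sum_map_range (g : ℕ → ℤ) (n : ℕ) :
    ((List.range n).map g).sum = ∑ i ∈ Finset.range n, g i := by
  induction n with
  | zero => simp
  | succ n ih => rw [List.range_succ, List.map_append, List.sum_append, ih, Finset.sum_range_succ]; simp

/-- `√2 ≤ 283/200`. [folklore] -/
private theorem sqrt_two_le : Real.sqrt 2 ≤ 283 / 200 := by
  rw [show (283 / 200 : ℝ) = Real.sqrt ((283 / 200) ^ 2) by rw [Real.sqrt_sq]; norm_num]
  exact Real.sqrt_le_sqrt (by norm_num)

/-- The shift identity behind `combine`'s `g_i = f_i − 2f_{i−1} + f_{i−2}`: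
`Σ_{i<m+2} g_i wⁱ = F_{m+2}(w) − 2w·F_{m+1}(w) + w²·F_m(w)`, `F_j := Σ_{i<j} f_i wⁱ`. [folklore] -/
private theorem gsum_eq {f g : ℕ → ℝ}
    (hg : ∀ i, g i = f i - 2 * (if i = 0 then 0 else f (i - 1)) + (if i < 2 then 0 else f (i - 2)))
    (w : ℝ) (m : ℕ) :
    ∑ i ∈ range (m + 2), g i * w ^ i
      = ∑ i ∈ range (m + 2), f i * w ^ i - 2 * w * ∑ i ∈ range (m + 1), f i * w ^ i
        + w ^ 2 * ∑ i ∈ range m, f i * w ^ i := by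
  have h1 : ∑ i ∈ range (m + 2), (if i = 0 then 0 else f (i - 1)) * w ^ i
      = w * ∑ i ∈ range (m + 1), f i * w ^ i := by
    rw [Finset.sum_range_succ']
    have e0 : (if (0 : ℕ) = 0 then (0 : ℝ) else f (0 - 1)) * w ^ 0 = 0 := by simp
    rw [e0, add_zero, Finset.mul_sum]
    refine Finset.sum_congr rfl fun i _ ↦ ?_
    rw [if_neg (by omega), show i + 1 - 1 = i by omega]
    ring
  have h2 : ∑ i ∈ range (m + 2), (if i < 2 then 0 else f (i - 2)) * w ^ i
      = w ^ 2 * ∑ i ∈ range m, f i * w ^ i := by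
    rw [Finset.sum_range_succ', Finset.sum_range_succ']
    have e0 : (if (0 : ℕ) < 2 then (0 : ℝ) else f (0 - 2)) * w ^ 0 = 0 := by simp
    have e1 : (if (0 + 1 : ℕ) < 2 then (0 : ℝ) else f (0 + 1 - 2)) * w ^ (0 + 1) = 0 := by simp
    rw [e0, e1, add_zero, add_zero, Finset.mul_sum]
    refine Finset.sum_congr rfl fun i _ ↦ ?_
    rw [if_neg (by omega), show i + 1 + 1 - 2 = i by omega]
    ring
  have h3 : ∑ i ∈ range (m + 2), g i * w ^ i
      = ∑ i ∈ range (m + 2), f i * w ^ i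
        - 2 * ∑ i ∈ range (m + 2), (if i = 0 then 0 else f (i - 1)) * w ^ i
        + ∑ i ∈ range (m + 2), (if i < 2 then 0 else f (i - 2)) * w ^ i := by
    rw [Finset.mul_sum, ← Finset.sum_sub_distrib, ← Finset.sum_add_distrib]
    refine Finset.sum_congr rfl fun i _ ↦ ?_
    rw [hg i]
    ring
  rw [h3, h1, h2]
  ring

/-! ## Soundness of the per-mode integers: the truncation bounds (i)–(v) -/

/-- `0 ≤ fAbs d k`. [cite: ConnesConsani2021, Prop. 5.3 / Lemma 5.4 §5 pp. 32–33 and §6.3–6.4 p. 24 (in-kernel certificate for the §6 kernel enclosure)] -/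
theorem fAbs_nonneg (d : ModeData) (k : ℕ) : 0 ≤ fAbs d k := by
  unfold fAbs MI.absHi
  exact le_max_of_le_left (abs_nonneg _)

/-- `0 ≤ ⌊fAbs/2ᵏ⌋ + 1`. [cite: ConnesConsani2021, Prop. 5.3 / Lemma 5.4 §5 pp. 32–33 and §6.3–6.4 p. 24 (in-kernel certificate for the §6 kernel enclosure)] -/
theorem fAbs_half_nonneg (d : ModeData) (k : ℕ) : 0 ≤ fAbs d k / 2 ^ k + 1 := by
  have := Int.ediv_nonneg (fAbs_nonneg d k) (by positivity : (0 : ℤ) ≤ 2 ^ k)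
  omega

/-- `0 ≤ FpB d`. [cite: ConnesConsani2021, Prop. 5.3 / Lemma 5.4 §5 pp. 32–33 and §6.3–6.4 p. 24 (in-kernel certificate for the §6 kernel enclosure)] -/
theorem FpB_nonneg (d : ModeData) : 0 ≤ FpB d :=
  add_nonneg (Finset.sum_nonneg fun k _ ↦ fAbs_nonneg d k) (by positivity)

/-- `0 ≤ toutB d Kout`. [cite: ConnesConsani2021, Prop. 5.3 / Lemma 5.4 §5 pp. 32–33 and §6.3–6.4 p. 24 (in-kernel certificate for the §6 kernel enclosure)] -/
theorem toutB_nonneg (d : ModeData) (Kout : ℕ) : 0 ≤ toutB d Kout :=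
  add_nonneg (Finset.sum_nonneg fun k _ ↦ fAbs_nonneg d k) (by positivity)

/-- `0 ≤ tinB d Kin`. [cite: ConnesConsani2021, Prop. 5.3 / Lemma 5.4 §5 pp. 32–33 and §6.3–6.4 p. 24 (in-kernel certificate for the §6 kernel enclosure)] -/
theorem tinB_nonneg (d : ModeData) (Kin : ℕ) : 0 ≤ tinB d Kin :=
  mul_nonneg (by norm_num) (add_nonneg (Finset.sum_nonneg fun k _ ↦ fAbs_half_nonneg d k) (by positivity))

/-- `0 ≤ GsB d Kin`. [cite: ConnesConsani2021, Prop. 5.3 / Lemma 5.4 §5 pp. 32–33 and §6.3–6.4 p. 24 (in-kernel certificate for the §6 kernel enclosure)] -/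
theorem GsB_nonneg (d : ModeData) (Kin : ℕ) : 0 ≤ GsB d Kin :=
  mul_nonneg (by norm_num) (Finset.sum_nonneg fun k _ ↦ fAbs_half_nonneg d k)

/-- `0 ≤ tHiB d`. [cite: ConnesConsani2021, Prop. 5.3 / Lemma 5.4 §5 pp. 32–33 and §6.3–6.4 p. 24 (in-kernel certificate for the §6 kernel enclosure)] -/
theorem tHiB_nonneg (d : ModeData) : 0 ≤ tHiB d := by
  unfold tHiB
  cases modeQuantities d with
  | none => exact le_rfl
  | some q => exact le_max_right _ _

/-- `t ≤ tHiB/S` for every real `t` in the `t`-interval of the quotient package. [cite: ConnesConsani2021, Prop. 5.3 / Lemma 5.4 §5 pp. 32–33 and §6.3–6.4 p. 24 (in-kernel certificate for the §6 kernel enclosure)] -/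
theorem le_tHiB {d : ModeData} {q : MI × MI × MI × MI} (hq : modeQuantities d = some q) {t : ℝ}
    (ht : MI.mem S t q.2.2.2) : t ≤ (tHiB d : ℝ) / S := by
  have h1 := MI.le_hi_div S_pos ht
  have h2 : (q.2.2.2.hi : ℝ) ≤ (tHiB d : ℝ) := by
    have : q.2.2.2.hi ≤ tHiB d := by unfold tHiB; rw [hq]; exact le_max_left _ _
    exact_mod_cast this
  exact h1.trans (div_le_div_of_nonneg_right h2 (by exact_mod_cast S_pos.le))

/-- `S·|f_k(χ)| ≤ fAbs d k`, `f_k = (k+1)·a_{k+1}`. [cite: ConnesConsani2021, Prop. 5.3 / Lemma 5.4 §5 pp. 32–33 and §6.3–6.4 p. 24 (in-kernel certificate for the §6 kernel enclosure)] -/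
theorem abs_f_mul_S_le_fAbs {χ : ℝ} {d : ModeData} (hχ : MI.mem S χ d.chi) (k : ℕ) :
    |((k : ℝ) + 1) * frobCoeff 1 χ (k + 1)| * S ≤ (fAbs d k : ℝ) := by
  have h := MI.abs_le_absHi (MI.mem_mulInt (mem_frobCoeffMI hχ (k + 1)) ((k : ℤ) + 1))
  have e : frobCoeff 1 χ (k + 1) * (((k : ℤ) + 1 : ℤ) : ℝ) = ((k : ℝ) + 1) * frobCoeff 1 χ (k + 1) := by
    push_cast; ring
  rw [e] at h
  exact h

/-- `|f_k(χ)|·|w|ᵏ ≤ (⌊fAbs/2ᵏ⌋ + 1)/S` for `|w| ≤ ½`. [cite: ConnesConsani2021, Prop. 5.3 / Lemma 5.4 §5 pp. 32–33 and §6.3–6.4 p. 24 (in-kernel certificate for the §6 kernel enclosure)] -/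
theorem abs_f_mul_pow_le_half {χ : ℝ} {d : ModeData} (hχ : MI.mem S χ d.chi) (k : ℕ) {w : ℝ}
    (hw : |w| ≤ 1 / 2) :
    |((k : ℝ) + 1) * frobCoeff 1 χ (k + 1)| * |w| ^ k ≤ ((fAbs d k / 2 ^ k + 1 : ℤ) : ℝ) / S := by
  have hS : (0 : ℝ) < (S : ℝ) := by exact_mod_cast S_pos
  have h1 := abs_f_mul_S_le_fAbs hχ k
  have hpow : |w| ^ k ≤ (1 / 2) ^ k := pow_le_pow_left₀ (abs_nonneg _) hw k
  have hfl := int_div_real_le_ediv_add_one (fAbs d k) (m := 2 ^ k) (by positivity)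
  push_cast at hfl
  rw [le_div_iff₀ hS]
  have h2 : |((k : ℝ) + 1) * frobCoeff 1 χ (k + 1)| * |w| ^ k * S
      ≤ (fAbs d k : ℝ) * (1 / 2) ^ k := by
    calc _ = |((k : ℝ) + 1) * frobCoeff 1 χ (k + 1)| * S * |w| ^ k := by ring
      _ ≤ (fAbs d k : ℝ) * (1 / 2) ^ k :=
          mul_le_mul h1 hpow (by positivity) (by exact_mod_cast fAbs_nonneg d k)
  have h3 : (fAbs d k : ℝ) * (1 / 2) ^ k = (fAbs d k : ℝ) / 2 ^ k := by
    rw [one_div, inv_pow]; ring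
  push_cast
  linarith [h2, h3, hfl]

/-- `|f_k(χ)|·|w|ᵏ ≤ fAbs/S` for `|w| ≤ 1`. [cite: ConnesConsani2021, Prop. 5.3 / Lemma 5.4 §5 pp. 32–33 and §6.3–6.4 p. 24 (in-kernel certificate for the §6 kernel enclosure)] -/
theorem abs_f_mul_pow_le_one {χ : ℝ} {d : ModeData} (hχ : MI.mem S χ d.chi) (k : ℕ) {w : ℝ}
    (hw : |w| ≤ 1) :
    |((k : ℝ) + 1) * frobCoeff 1 χ (k + 1)| * |w| ^ k ≤ (fAbs d k : ℝ) / S := by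
  have hS : (0 : ℝ) < (S : ℝ) := by exact_mod_cast S_pos
  rw [le_div_iff₀ hS]
  calc _ ≤ |((k : ℝ) + 1) * frobCoeff 1 χ (k + 1)| * 1 * S := by
        gcongr; exact pow_le_one₀ (abs_nonneg _) hw
    _ = |((k : ℝ) + 1) * frobCoeff 1 χ (k + 1)| * S := by ring
    _ ≤ _ := abs_f_mul_S_le_fAbs hχ k

/-- **The split truncation on the window** `y ∈ [0, 2]` (`w = 1 − y`, `|w| ≤ 1`): for any `Kt ≤ K`,
`|u′(y) + Σ_{k<Kt} f_k wᵏ| ≤ Σ_{Kt≤k<K} |f_k|·|w|ᵏ + DT/S`. [cite: CoddingtonLevinson1955, Ch. 4 §8] -/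
theorem abs_frobSol₁_add_sum_le_partial {χ : ℝ} {d : ModeData} (hχ : MI.mem S χ d.chi)
    (hT : tailCheckMI d.chi d.K d.tail = true) {Kt : ℕ} (hKt : Kt ≤ d.K) {y : ℝ} (hy : y ∈ Icc (0 : ℝ) 2) :
    |frobSol₁ 1 χ y + ∑ k ∈ range Kt, ((k : ℝ) + 1) * frobCoeff 1 χ (k + 1) * (1 - y) ^ k|
      ≤ (∑ k ∈ Ico Kt d.K, |((k : ℝ) + 1) * frobCoeff 1 χ (k + 1)| * |1 - y| ^ k) + (d.tail.DT : ℝ) / S := by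
  have hK := abs_frobSol₁_add_sum_le_of_tailCheckMI hχ hT hy
  set F : ℕ → ℝ := fun k ↦ ((k : ℝ) + 1) * frobCoeff 1 χ (k + 1) * (1 - y) ^ k with hF
  have hsplit := Finset.sum_range_add_sum_Ico F hKt
  have e : frobSol₁ 1 χ y + ∑ k ∈ range Kt, F k
      = (frobSol₁ 1 χ y + ∑ k ∈ range d.K, F k) - ∑ k ∈ Ico Kt d.K, F k := by
    rw [← hsplit]; ring
  rw [e]
  calc _ ≤ |frobSol₁ 1 χ y + ∑ k ∈ range d.K, F k| + |∑ k ∈ Ico Kt d.K, F k| := abs_sub _ _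
    _ ≤ (d.tail.DT : ℝ) / S + ∑ k ∈ Ico Kt d.K, |((k : ℝ) + 1) * frobCoeff 1 χ (k + 1)| * |1 - y| ^ k := by
        refine add_le_add hK ((Finset.abs_sum_le_sum_abs _ _).trans (Finset.sum_le_sum fun k _ ↦ ?_))
        rw [hF]
        simp only [abs_mul, abs_pow]
        exact le_rfl
    _ = _ := add_comm _ _

/-- **(iv) outer truncation** on `y ∈ [1, 2]`: `|u′(y) + Σ_{j<Kout} f_j (1−y)ʲ| ≤ toutB/S` for any `f` agreeing with
`(j+1)·a_{j+1}(χ)` below `Kout` (`Kout ≤ K`). [cite: ConnesConsani2021, Prop. 5.3 / Lemma 5.4 §5 pp. 32–33 and §6.3–6.4 p. 24 (in-kernel certificate for the §6 kernel enclosure)] -/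
theorem abs_frobSol₁_add_sum_le_toutB {χ : ℝ} {d : ModeData} (hχ : MI.mem S χ d.chi)
    (hT : tailCheckMI d.chi d.K d.tail = true) {Kout : ℕ} (hKout : Kout ≤ d.K) {f : ℕ → ℝ}
    (hf : ∀ k < Kout, f k = ((k : ℝ) + 1) * frobCoeff 1 χ (k + 1)) {y : ℝ} (hy : y ∈ Icc (1 : ℝ) 2) :
    |frobSol₁ 1 χ y + ∑ j ∈ range Kout, f j * (1 - y) ^ j| ≤ (toutB d Kout : ℝ) / S := by
  have hy' : y ∈ Icc (0 : ℝ) 2 := ⟨by linarith [hy.1], hy.2⟩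
  have hw : |1 - y| ≤ 1 := abs_le.2 ⟨by linarith [hy.2], by linarith [hy.1]⟩
  have hsum : ∑ j ∈ range Kout, f j * (1 - y) ^ j
      = ∑ k ∈ range Kout, ((k : ℝ) + 1) * frobCoeff 1 χ (k + 1) * (1 - y) ^ k :=
    Finset.sum_congr rfl fun k hk ↦ by rw [hf k (Finset.mem_range.1 hk)]
  rw [hsum]
  have h := abs_frobSol₁_add_sum_le_partial hχ hT hKout hy'
  refine h.trans ?_
  have hterm : ∀ k ∈ Finset.Ico Kout d.K,
      |((k : ℝ) + 1) * frobCoeff 1 χ (k + 1)| * |1 - y| ^ k ≤ (fAbs d k : ℝ) / S :=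
    fun k _ ↦ abs_f_mul_pow_le_one hχ k hw
  calc _ ≤ (∑ k ∈ Ico Kout d.K, (fAbs d k : ℝ) / S) + (d.tail.DT : ℝ) / S := by
        gcongr with k hk; exact hterm k hk
    _ = (toutB d Kout : ℝ) / S := by
        unfold toutB; push_cast; rw [← Finset.sum_div, ← add_div]

/-- **(v) the derivative is bounded** on the window `y ∈ [0, 2]`: `|u′(y)| ≤ FpB/S`. [cite: ConnesConsani2021, Prop. 5.3 / Lemma 5.4 §5 pp. 32–33 and §6.3–6.4 p. 24 (in-kernel certificate for the §6 kernel enclosure)] -/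
theorem abs_frobSol₁_le_FpB {χ : ℝ} {d : ModeData} (hχ : MI.mem S χ d.chi)
    (hT : tailCheckMI d.chi d.K d.tail = true) {y : ℝ} (hy : y ∈ Icc (0 : ℝ) 2) :
    |frobSol₁ 1 χ y| ≤ (FpB d : ℝ) / S := by
  have hw : |1 - y| ≤ 1 := abs_le.2 ⟨by linarith [hy.2], by linarith [hy.1]⟩
  have h := abs_frobSol₁_add_sum_le_partial hχ hT (le_refl d.K) hy
  -- with `Kt = K` the middle sum is empty
  rw [Finset.Ico_self, Finset.sum_empty, zero_add] at h
  set P : ℝ := ∑ k ∈ range d.K, ((k : ℝ) + 1) * frobCoeff 1 χ (k + 1) * (1 - y) ^ k with hP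
  have hPb : |P| ≤ ∑ k ∈ range d.K, (fAbs d k : ℝ) / S := by
    refine (Finset.abs_sum_le_sum_abs _ _).trans (Finset.sum_le_sum fun k _ ↦ ?_)
    rw [abs_mul, abs_pow]
    exact abs_f_mul_pow_le_one hχ k hw
  calc |frobSol₁ 1 χ y| = |(frobSol₁ 1 χ y + P) - P| := by ring_nf
    _ ≤ |frobSol₁ 1 χ y + P| + |P| := abs_sub _ _
    _ ≤ (d.tail.DT : ℝ) / S + ∑ k ∈ range d.K, (fAbs d k : ℝ) / S := add_le_add h hPb
    _ = (FpB d : ℝ) / S := by unfold FpB; push_cast; rw [← Finset.sum_div, ← add_div, add_comm]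

/-- **(ii) inner truncation** on `x ∈ [½, 1]` (`w = 1 − x ∈ [0, ½]`): `|u′(x) + Σ_{i<Kin} f_i (1−x)ⁱ| ≤ tinB/S`
(`2 ≤ Kin ≤ K`). [cite: ConnesConsani2021, Prop. 5.3 / Lemma 5.4 §5 pp. 32–33 and §6.3–6.4 p. 24 (in-kernel certificate for the §6 kernel enclosure)] -/
theorem abs_frobSol₁_add_sum_le_tinB {χ : ℝ} {d : ModeData} (hχ : MI.mem S χ d.chi)
    (hT : tailCheckMI d.chi d.K d.tail = true) {Kin : ℕ} (h2 : 2 ≤ Kin) (hKin : Kin ≤ d.K) {f : ℕ → ℝ}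
    (hf : ∀ k < Kin, f k = ((k : ℝ) + 1) * frobCoeff 1 χ (k + 1)) {x : ℝ} (hx : x ∈ Icc (1 / 2 : ℝ) 1) :
    |frobSol₁ 1 χ x + ∑ i ∈ range Kin, f i * (1 - x) ^ i| ≤ (tinB d Kin : ℝ) / S := by
  have hS : (0 : ℝ) < (S : ℝ) := by exact_mod_cast S_pos
  have hx' : x ∈ Icc (0 : ℝ) 2 := ⟨by linarith [hx.1], by linarith [hx.2]⟩
  have hw : |1 - x| ≤ 1 / 2 := abs_le.2 ⟨by linarith [hx.2], by linarith [hx.1]⟩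
  have hsum : ∑ i ∈ range Kin, f i * (1 - x) ^ i
      = ∑ k ∈ range Kin, ((k : ℝ) + 1) * frobCoeff 1 χ (k + 1) * (1 - x) ^ k :=
    Finset.sum_congr rfl fun k hk ↦ by rw [hf k (Finset.mem_range.1 hk)]
  rw [hsum]
  have h := abs_frobSol₁_add_sum_le_partial hχ hT hKin hx'
  refine h.trans ?_
  have hmid : ∑ k ∈ Ico Kin d.K, |((k : ℝ) + 1) * frobCoeff 1 χ (k + 1)| * |1 - x| ^ k
      ≤ ∑ k ∈ Ico (Kin - 2) d.K, ((fAbs d k / 2 ^ k + 1 : ℤ) : ℝ) / S := by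
    calc _ ≤ ∑ k ∈ Ico Kin d.K, ((fAbs d k / 2 ^ k + 1 : ℤ) : ℝ) / S :=
          Finset.sum_le_sum fun k _ ↦ abs_f_mul_pow_le_half hχ k hw
      _ ≤ _ := by
          refine Finset.sum_le_sum_of_subset_of_nonneg (Finset.Ico_subset_Ico (by omega) le_rfl) ?_
          intro k _ _
          exact div_nonneg (by exact_mod_cast fAbs_half_nonneg d k) hS.le
  have hB : (∑ k ∈ Ico (Kin - 2) d.K, ((fAbs d k / 2 ^ k + 1 : ℤ) : ℝ) / S) + (d.tail.DT : ℝ) / S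
      ≤ (tinB d Kin : ℝ) / S := by
    have h0 : (0 : ℝ) ≤ ∑ k ∈ Ico (Kin - 2) d.K, ((fAbs d k / 2 ^ k + 1 : ℤ) : ℝ) :=
      Finset.sum_nonneg fun k _ ↦ by exact_mod_cast fAbs_half_nonneg d k
    have hDT : (0 : ℝ) ≤ (d.tail.DT : ℝ) := by positivity
    have e : (tinB d Kin : ℝ)
        = 4 * ((∑ k ∈ Ico (Kin - 2) d.K, ((fAbs d k / 2 ^ k + 1 : ℤ) : ℝ)) + (d.tail.DT : ℝ)) := by
      unfold tinB; push_cast; rfl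
    rw [← Finset.sum_div, ← add_div, e]
    exact div_le_div_of_nonneg_right (by nlinarith) hS.le
  linarith [hmid, hB]

/-- **(iii) the truncated `g`-polynomial is bounded** on `x ∈ [½, 1]`: `|Σ_{i<Kin} g_i (1−x)ⁱ| ≤ GsB/S`
(`g_i = f_i − 2f_{i−1} + f_{i−2}`, `2 ≤ Kin`). [cite: ConnesConsani2021, Prop. 5.3 / Lemma 5.4 §5 pp. 32–33 and §6.3–6.4 p. 24 (in-kernel certificate for the §6 kernel enclosure)] -/
theorem abs_gsum_le_GsB {χ : ℝ} {d : ModeData} (hχ : MI.mem S χ d.chi) {Kin : ℕ} (h2 : 2 ≤ Kin)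
    {f g : ℕ → ℝ} (hf : ∀ k < Kin, f k = ((k : ℝ) + 1) * frobCoeff 1 χ (k + 1))
    (hg : ∀ i, g i = f i - 2 * (if i = 0 then 0 else f (i - 1)) + (if i < 2 then 0 else f (i - 2)))
    {x : ℝ} (hx : x ∈ Icc (1 / 2 : ℝ) 1) :
    |∑ i ∈ range Kin, g i * (1 - x) ^ i| ≤ (GsB d Kin : ℝ) / S := by
  have hS : (0 : ℝ) < (S : ℝ) := by exact_mod_cast S_pos
  obtain ⟨m, rfl⟩ : ∃ m, Kin = m + 2 := ⟨Kin - 2, by omega⟩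
  set w : ℝ := 1 - x with hwdef
  have hw0 : 0 ≤ w := by rw [hwdef]; linarith [hx.2]
  have hw2 : w ≤ 1 / 2 := by rw [hwdef]; linarith [hx.1]
  have hwabs : |w| ≤ 1 / 2 := by rw [abs_of_nonneg hw0]; exact hw2
  rw [gsum_eq hg w m]
  -- the partial sums `F_j`, all dominated by `P := Σ_{i<m+2} |f_i| wⁱ`
  set P : ℝ := ∑ i ∈ range (m + 2), |f i| * w ^ i with hP
  have hPj : ∀ j ≤ m + 2, |∑ i ∈ range j, f i * w ^ i| ≤ P := by
    intro j hj
    calc _ ≤ ∑ i ∈ range j, |f i * w ^ i| := Finset.abs_sum_le_sum_abs _ _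
      _ = ∑ i ∈ range j, |f i| * w ^ i := Finset.sum_congr rfl fun i _ ↦ by
          rw [abs_mul, abs_pow, abs_of_nonneg hw0]
      _ ≤ P := Finset.sum_le_sum_of_subset_of_nonneg (Finset.range_subset_range.2 hj)
          fun i _ _ ↦ by positivity
  have hP0 : 0 ≤ P := Finset.sum_nonneg fun i _ ↦ by positivity
  -- `P ≤ Σ (⌊fAbs/2^i⌋+1)/S`
  have hPle : P ≤ ∑ i ∈ range (m + 2), ((fAbs d i / 2 ^ i + 1 : ℤ) : ℝ) / S := by
    refine Finset.sum_le_sum fun i hi ↦ ?_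
    have hi' := Finset.mem_range.1 hi
    have := abs_f_mul_pow_le_half hχ i hwabs
    rw [abs_of_nonneg hw0] at this
    rw [hf i hi']
    exact this
  have e1 := hPj (m + 2) le_rfl
  have e2 := hPj (m + 1) (by omega)
  have e3 := hPj m (by omega)
  have hGs : (GsB d (m + 2) : ℝ) / S = 4 * ∑ i ∈ range (m + 2), ((fAbs d i / 2 ^ i + 1 : ℤ) : ℝ) / S := by
    unfold GsB; push_cast; rw [Finset.mul_sum, Finset.mul_sum, Finset.sum_div]
    refine Finset.sum_congr rfl fun i _ ↦ ?_
    ring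
  have habs : |∑ i ∈ range (m + 2), f i * w ^ i - 2 * w * ∑ i ∈ range (m + 1), f i * w ^ i
          + w ^ 2 * ∑ i ∈ range m, f i * w ^ i|
      ≤ |∑ i ∈ range (m + 2), f i * w ^ i| + 2 * w * |∑ i ∈ range (m + 1), f i * w ^ i|
          + w ^ 2 * |∑ i ∈ range m, f i * w ^ i| := by
    have t1 := abs_add_three (∑ i ∈ range (m + 2), f i * w ^ i) (-(2 * w * ∑ i ∈ range (m + 1), f i * w ^ i))
      (w ^ 2 * ∑ i ∈ range m, f i * w ^ i)
    rw [abs_neg, abs_mul (2 * w), abs_mul (w ^ 2), abs_of_nonneg (by positivity : (0 : ℝ) ≤ 2 * w),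
      abs_of_nonneg (by positivity : (0 : ℝ) ≤ w ^ 2)] at t1
    have e : ∑ i ∈ range (m + 2), f i * w ^ i + -(2 * w * ∑ i ∈ range (m + 1), f i * w ^ i)
        + w ^ 2 * ∑ i ∈ range m, f i * w ^ i
        = ∑ i ∈ range (m + 2), f i * w ^ i - 2 * w * ∑ i ∈ range (m + 1), f i * w ^ i
          + w ^ 2 * ∑ i ∈ range m, f i * w ^ i := by ring
    rw [e] at t1
    exact t1
  calc _ ≤ |∑ i ∈ range (m + 2), f i * w ^ i| + 2 * w * |∑ i ∈ range (m + 1), f i * w ^ i|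
          + w ^ 2 * |∑ i ∈ range m, f i * w ^ i| := habs
    _ ≤ P + 2 * w * P + w ^ 2 * P := by gcongr
    _ ≤ (9 / 4) * P := by
        have hw' : 2 * w + w ^ 2 ≤ 5 / 4 := by nlinarith [hw0, hw2]
        nlinarith [mul_le_mul_of_nonneg_left hw' hP0]
    _ ≤ 4 * ∑ i ∈ range (m + 2), ((fAbs d i / 2 ^ i + 1 : ℤ) : ℝ) / S := by nlinarith [hPle]
    _ = (GsB d (m + 2) : ℝ) / S := hGs.symm

/-- **(i) inner truncation of `x²u′`** on `x ∈ [½, 1]`: `|x²·u′(x) + Σ_{i<Kin} g_i (1−x)ⁱ| ≤ tinB/S`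
(`2 ≤ Kin ≤ K`; `x²u′ + G_{Kin} = R_{Kin} − 2w·R_{Kin−1} + w²·R_{Kin−2}` with `R_j := u′ + F_j`). [cite: ConnesConsani2021, Prop. 5.3 / Lemma 5.4 §5 pp. 32–33 and §6.3–6.4 p. 24 (in-kernel certificate for the §6 kernel enclosure)] -/
theorem abs_sq_mul_frobSol₁_add_gsum_le_tinB {χ : ℝ} {d : ModeData} (hχ : MI.mem S χ d.chi)
    (hT : tailCheckMI d.chi d.K d.tail = true) {Kin : ℕ} (h2 : 2 ≤ Kin) (hKin : Kin ≤ d.K)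
    {f g : ℕ → ℝ} (hf : ∀ k < Kin, f k = ((k : ℝ) + 1) * frobCoeff 1 χ (k + 1))
    (hg : ∀ i, g i = f i - 2 * (if i = 0 then 0 else f (i - 1)) + (if i < 2 then 0 else f (i - 2)))
    {x : ℝ} (hx : x ∈ Icc (1 / 2 : ℝ) 1) :
    |x ^ 2 * frobSol₁ 1 χ x + ∑ i ∈ range Kin, g i * (1 - x) ^ i| ≤ (tinB d Kin : ℝ) / S := by
  have hS : (0 : ℝ) < (S : ℝ) := by exact_mod_cast S_pos
  obtain ⟨m, rfl⟩ : ∃ m, Kin = m + 2 := ⟨Kin - 2, by omega⟩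
  have hx' : x ∈ Icc (0 : ℝ) 2 := ⟨by linarith [hx.1], by linarith [hx.2]⟩
  set w : ℝ := 1 - x with hwdef
  have hw0 : 0 ≤ w := by rw [hwdef]; linarith [hx.2]
  have hw2 : w ≤ 1 / 2 := by rw [hwdef]; linarith [hx.1]
  have hwabs : |w| ≤ 1 / 2 := by rw [abs_of_nonneg hw0]; exact hw2
  rw [gsum_eq hg w m]
  -- replace the `f`-partial sums by the genuine ones (indices `< m + 2 = Kin`)
  have hFj : ∀ j ≤ m + 2, ∑ i ∈ range j, f i * w ^ i
      = ∑ k ∈ range j, ((k : ℝ) + 1) * frobCoeff 1 χ (k + 1) * (1 - x) ^ k := by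
    intro j hj
    exact Finset.sum_congr rfl fun k hk ↦ by rw [hf k (by have := Finset.mem_range.1 hk; omega)]
  rw [hFj (m + 2) le_rfl, hFj (m + 1) (by omega), hFj m (by omega)]
  set R : ℕ → ℝ := fun j ↦ frobSol₁ 1 χ x +
    ∑ k ∈ range j, ((k : ℝ) + 1) * frobCoeff 1 χ (k + 1) * (1 - x) ^ k with hR
  have hx2 : x ^ 2 = 1 - 2 * w + w ^ 2 := by rw [hwdef]; ring
  have e : x ^ 2 * frobSol₁ 1 χ x
      + (∑ k ∈ range (m + 2), ((k : ℝ) + 1) * frobCoeff 1 χ (k + 1) * (1 - x) ^ k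
          - 2 * w * ∑ k ∈ range (m + 1), ((k : ℝ) + 1) * frobCoeff 1 χ (k + 1) * (1 - x) ^ k
          + w ^ 2 * ∑ k ∈ range m, ((k : ℝ) + 1) * frobCoeff 1 χ (k + 1) * (1 - x) ^ k)
      = R (m + 2) - 2 * w * R (m + 1) + w ^ 2 * R m := by
    simp only [hR]; rw [hx2]; ring
  rw [e]
  -- each `R j` is bounded by `Q := Σ_{m≤k<K} (⌊fAbs/2^k⌋+1)/S + DT/S`
  set Q : ℝ := (∑ k ∈ Ico m d.K, ((fAbs d k / 2 ^ k + 1 : ℤ) : ℝ) / S) + (d.tail.DT : ℝ) / S with hQ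
  have hQ0 : 0 ≤ Q := add_nonneg (Finset.sum_nonneg fun k _ ↦
    div_nonneg (by exact_mod_cast fAbs_half_nonneg d k) hS.le) (by positivity)
  have hRj : ∀ j, m ≤ j → j ≤ m + 2 → |R j| ≤ Q := by
    intro j hj1 hj2
    have h := abs_frobSol₁_add_sum_le_partial hχ hT (show j ≤ d.K by omega) hx'
    refine h.trans (add_le_add ?_ le_rfl)
    calc _ ≤ ∑ k ∈ Ico j d.K, ((fAbs d k / 2 ^ k + 1 : ℤ) : ℝ) / S :=
          Finset.sum_le_sum fun k _ ↦ abs_f_mul_pow_le_half hχ k hwabs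
      _ ≤ _ := Finset.sum_le_sum_of_subset_of_nonneg (Finset.Ico_subset_Ico hj1 le_rfl)
          fun k _ _ ↦ div_nonneg (by exact_mod_cast fAbs_half_nonneg d k) hS.le
  have e1 := hRj (m + 2) (by omega) le_rfl
  have e2 := hRj (m + 1) (by omega) (by omega)
  have e3 := hRj m le_rfl (by omega)
  have hQt : (9 / 4) * Q ≤ (tinB d (m + 2) : ℝ) / S := by
    have et : ((tinB d (m + 2) : ℤ) : ℝ)
        = 4 * ((∑ k ∈ Finset.Ico m d.K, ((fAbs d k / 2 ^ k + 1 : ℤ) : ℝ)) + (d.tail.DT : ℝ)) := by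
      unfold tinB; push_cast; rfl
    have e4 : (tinB d (m + 2) : ℝ) / S = 4 * Q := by
      rw [et, hQ, ← Finset.sum_div, ← add_div]; ring
    rw [e4]
    nlinarith [hQ0]
  have habs : |R (m + 2) - 2 * w * R (m + 1) + w ^ 2 * R m|
      ≤ |R (m + 2)| + 2 * w * |R (m + 1)| + w ^ 2 * |R m| := by
    have t1 := abs_add_three (R (m + 2)) (-(2 * w * R (m + 1))) (w ^ 2 * R m)
    rw [abs_neg, abs_mul (2 * w), abs_mul (w ^ 2), abs_of_nonneg (by positivity : (0 : ℝ) ≤ 2 * w),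
      abs_of_nonneg (by positivity : (0 : ℝ) ≤ w ^ 2)] at t1
    have e' : R (m + 2) + -(2 * w * R (m + 1)) + w ^ 2 * R m
        = R (m + 2) - 2 * w * R (m + 1) + w ^ 2 * R m := by ring
    rw [e'] at t1
    exact t1
  calc _ ≤ |R (m + 2)| + 2 * w * |R (m + 1)| + w ^ 2 * |R m| := habs
    _ ≤ Q + 2 * w * Q + w ^ 2 * Q := by gcongr
    _ ≤ (9 / 4) * Q := by
        have hw' : 2 * w + w ^ 2 ≤ 5 / 4 := by nlinarith [hw0, hw2]
        nlinarith [mul_le_mul_of_nonneg_left hw' hQ0]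
    _ ≤ (tinB d (m + 2) : ℝ) / S := hQt

/-! ## (vi) The allowance inequality -/

/-- `modes.getD n dflt = modeAt n` for `n < 8`. [cite: ConnesConsani2021, Prop. 5.3 / Lemma 5.4 §5 pp. 32–33 and §6.3–6.4 p. 24 (in-kernel certificate for the §6 kernel enclosure)] -/
theorem getD_eq_modeAt {n : ℕ} (hn : n < 8) (dflt : ModeData) : modes.getD n dflt = modeAt n := by
  unfold modeAt
  rw [List.getD_eq_getElem _ _ (by rw [length_modes]; exact hn),
    List.getD_eq_getElem _ _ (by rw [length_modes]; exact hn)]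

/-- The per-mode residual in reals is dominated by `residInt/(200·S²)`. [cite: ConnesConsani2021, Prop. 5.3 / Lemma 5.4 §5 pp. 32–33 and §6.3–6.4 p. 24 (in-kernel certificate for the §6 kernel enclosure)] -/
theorem resid_le_residInt (n : ℕ) :
    Real.sqrt 2 * ((tinB (modeAt n) 24 : ℝ) / S * ((FpB (modeAt n) : ℝ) / S)
        + (GsB (modeAt n) 24 : ℝ) / S * ((toutB (modeAt n) (koutAt n) : ℝ) / S))
      + (tinB (modeAt n) 24 : ℝ) / S + 2 * Real.sqrt 2 * ((toutB (modeAt n) (koutAt n) : ℝ) / S)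
      ≤ (residInt n : ℝ) / (200 * (S : ℝ) ^ 2) := by
  have hS : (0 : ℝ) < (S : ℝ) := by exact_mod_cast S_pos
  have h2 := sqrt_two_le
  have h20 : 0 ≤ Real.sqrt 2 := Real.sqrt_nonneg _
  have htin : (0 : ℝ) ≤ tinB (modeAt n) 24 := by exact_mod_cast tinB_nonneg _ _
  have hFp : (0 : ℝ) ≤ FpB (modeAt n) := by exact_mod_cast FpB_nonneg _
  have hGs : (0 : ℝ) ≤ GsB (modeAt n) 24 := by exact_mod_cast GsB_nonneg _ _
  have htout : (0 : ℝ) ≤ toutB (modeAt n) (koutAt n) := by exact_mod_cast toutB_nonneg _ _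
  unfold residInt
  push_cast
  rw [le_div_iff₀ (by positivity)]
  have hA : 0 ≤ (tinB (modeAt n) 24 : ℝ) * FpB (modeAt n) + GsB (modeAt n) 24 * toutB (modeAt n) (koutAt n) := by
    positivity
  -- clear denominators by hand
  have e : (Real.sqrt 2 * ((tinB (modeAt n) 24 : ℝ) / S * ((FpB (modeAt n) : ℝ) / S)
        + (GsB (modeAt n) 24 : ℝ) / S * ((toutB (modeAt n) (koutAt n) : ℝ) / S))
      + (tinB (modeAt n) 24 : ℝ) / S + 2 * Real.sqrt 2 * ((toutB (modeAt n) (koutAt n) : ℝ) / S))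
        * (200 * (S : ℝ) ^ 2)
      = 200 * Real.sqrt 2 * ((tinB (modeAt n) 24 : ℝ) * FpB (modeAt n)
          + GsB (modeAt n) 24 * toutB (modeAt n) (koutAt n))
        + 200 * S * tinB (modeAt n) 24 + 400 * Real.sqrt 2 * S * toutB (modeAt n) (koutAt n) := by
    field_simp
    ring
  rw [e]
  nlinarith [mul_le_mul_of_nonneg_right h2 hA, mul_le_mul_of_nonneg_right h2 (mul_nonneg hS.le htout)]

/-- **(vi) the allowance inequality**: for any reals `t n` lying in the `t`-intervals of the eight modes of
record (e.g. `t n = epsSlopeTerm (prolateFun n)` by `mem_epsSlopeTerm_of_lt_eight`, or the `t` of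
`mode_package_of_mem_modes`), `Σ_{n<8} t n · (√2·(δG·A + B·δo) + δi + 2√2·δo) ≤ combinedLit.W / S` with
`δG = δi = tinB/S`, `A = FpB/S`, `B = GsB/S`, `δo = toutB/S` at `Kin = 24`, `Kout = koutAt n`. [cite: ConnesConsani2021, Prop. 5.3 / Lemma 5.4 §5 pp. 32–33 and §6.3–6.4 p. 24 (in-kernel certificate for the §6 kernel enclosure)] -/
theorem wBound (dflt : ModeData) {t : ℕ → ℝ}
    (ht : ∀ n < 8, ∀ q : MI × MI × MI × MI, modeQuantities (modes.getD n dflt) = some q →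
      MI.mem S (t n) q.2.2.2) :
    ∑ n ∈ range 8, t n *
        (Real.sqrt 2 * ((tinB (modes.getD n dflt) 24 : ℝ) / S * ((FpB (modes.getD n dflt) : ℝ) / S)
            + (GsB (modes.getD n dflt) 24 : ℝ) / S * ((toutB (modes.getD n dflt) (koutAt n) : ℝ) / S))
          + (tinB (modes.getD n dflt) 24 : ℝ) / S
          + 2 * Real.sqrt 2 * ((toutB (modes.getD n dflt) (koutAt n) : ℝ) / S))
      ≤ (ArchCertT2.combinedLit.W : ℝ) / S := by
  have hS : (0 : ℝ) < (S : ℝ) := by exact_mod_cast S_pos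
  -- the kernel check, as a real inequality
  have hc := wCheck_eq_true
  rw [wCheck, decide_eq_true_eq, list_sum_map_range] at hc
  have hcr : ((∑ n ∈ range 8, tHiB (modeAt n) * residInt n : ℤ) : ℝ)
      ≤ ((200 * (S : ℤ) * (S : ℤ) * ArchCertT2.combinedLit.W : ℤ) : ℝ) := by exact_mod_cast hc
  push_cast at hcr
  -- per-mode domination
  have hmode : ∀ n ∈ range 8, t n *
        (Real.sqrt 2 * ((tinB (modes.getD n dflt) 24 : ℝ) / S * ((FpB (modes.getD n dflt) : ℝ) / S)
            + (GsB (modes.getD n dflt) 24 : ℝ) / S * ((toutB (modes.getD n dflt) (koutAt n) : ℝ) / S))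
          + (tinB (modes.getD n dflt) 24 : ℝ) / S
          + 2 * Real.sqrt 2 * ((toutB (modes.getD n dflt) (koutAt n) : ℝ) / S))
      ≤ (tHiB (modeAt n) : ℝ) * residInt n / (200 * (S : ℝ) ^ 3) := by
    intro n hn
    have hn8 := Finset.mem_range.1 hn
    rw [getD_eq_modeAt hn8]
    obtain ⟨q, hq⟩ := modeQuantities_isSome_of_mem_modes (getD_mem_modes hn8 dflt)
    have htle : t n ≤ (tHiB (modeAt n) : ℝ) / S := by
      have := le_tHiB hq (ht n hn8 q hq)
      rwa [getD_eq_modeAt hn8] at this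
    have hres := resid_le_residInt n
    have hres0 : 0 ≤ Real.sqrt 2 * ((tinB (modeAt n) 24 : ℝ) / S * ((FpB (modeAt n) : ℝ) / S)
        + (GsB (modeAt n) 24 : ℝ) / S * ((toutB (modeAt n) (koutAt n) : ℝ) / S))
        + (tinB (modeAt n) 24 : ℝ) / S + 2 * Real.sqrt 2 * ((toutB (modeAt n) (koutAt n) : ℝ) / S) := by
      have htin : (0 : ℝ) ≤ tinB (modeAt n) 24 := by exact_mod_cast tinB_nonneg _ _
      have hFp : (0 : ℝ) ≤ FpB (modeAt n) := by exact_mod_cast FpB_nonneg _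
      have hGs : (0 : ℝ) ≤ GsB (modeAt n) 24 := by exact_mod_cast GsB_nonneg _ _
      have htout : (0 : ℝ) ≤ toutB (modeAt n) (koutAt n) := by exact_mod_cast toutB_nonneg _ _
      positivity
    have hTH : (0 : ℝ) ≤ (tHiB (modeAt n) : ℝ) / S :=
      div_nonneg (by exact_mod_cast tHiB_nonneg _) hS.le
    calc _ ≤ (tHiB (modeAt n) : ℝ) / S * ((residInt n : ℝ) / (200 * (S : ℝ) ^ 2)) :=
          mul_le_mul htle hres hres0 hTH
      _ = _ := by field_simp
  calc _ ≤ ∑ n ∈ range 8, (tHiB (modeAt n) : ℝ) * residInt n / (200 * (S : ℝ) ^ 3) :=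
        Finset.sum_le_sum hmode
    _ = (∑ n ∈ range 8, (tHiB (modeAt n) : ℝ) * residInt n) / (200 * (S : ℝ) ^ 3) := by
        rw [Finset.sum_div]
    _ ≤ (200 * (S : ℝ) * S * ArchCertT2.combinedLit.W) / (200 * (S : ℝ) ^ 3) :=
        div_le_div_of_nonneg_right hcr (by positivity)
    _ = (ArchCertT2.combinedLit.W : ℝ) / S := by field_simp


end Literature.NumberTheory.ConnesConsani2021.ArchCert

end
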